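import Literature.Computability.Cryptography.QuantumTuringMachineLocalRule
import HarnessLib

/-!
# Oblivious sweep machines: a synchronous normal form for constructed quantum Turing machines

Toolkit file (Bernstein–Vazirani 1997, §4 and App. B; Nishimura–Ozawa 2002, Lemma 5.1). The
constructions "QTMs carry out polynomial-time classical computation and uniform quantum circuit
families with data-independent timing" (BV Thm. 4.3, the synchronisation theorem; BV App. B,
Def. B.5: an *oblivious* machine is one whose head position at each time depends only on the
input length; NO Lemma 5.1) are organised here around ONE generic machine, the **sweep machine**
of a `QTM.SweepSpec`:

* the tape alphabet is `Option (QTM.SCell C)`: blank (`none`, outside the work region), the two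
  end markers `endL`/`endR`, and live cells carrying a symbol of `C`;
* the control state is a motion component (`sweepR`, `pushR`, `sweepL`, `pushL`) times a finite
  *control register* `Φ`;
* the head zigzags over the work region: moving right it applies the bijection
  `ruleR : Φ × C ≃ Φ × C` to (register, live cell) at every cell; at the right end marker it
  turns the marker cell into a `pad` cell, steps onto the blank beyond, writes the marker there
  and turns round — and in THIS step (reading a blank, so that nothing on the tape is involved)
  the unitary `turn : Φ → Φ → ℂ` acts on the control register: the only non-classical
  transition of the machine (in the applications: a quantum gate applied to qubits parked in the
  register); moving left it applies `ruleL`, and at the left end it moves the left marker out by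
  one cell likewise (classically);
* on the very first sweep there are no markers yet: the first blank met on either side plays
  their role and receives the distinguished live cells `anchorR`/`anchorL` (this is how the
  input word, which the tree's `QTM.init` lays out without any markers, is absorbed).

Everything about such a machine is data independent except the contents of `Φ` and of the live
cells: after `s` sweeps on an input of length `n` the work region is `[-(s+1), n+s]` (markers
included), the head is at its left end, and sweep `s` takes exactly `2(n + 2s) + 5` steps, so the
`s`-th sweep boundary is the time `QTM.SweepSpec.sweepTime n s = 2s² + (2n+3)s` — a polynomial.

Main results (all proved):

* `QTM.SweepSpec.machine` — the machine, an instance of `QTM.ofRule` (`…LocalRule.lean`) whose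
  bijection is the completion (`QTM.completeRule`, BV App. B Cor. B.2) of the injective partial
  table `QTM.SweepSpec.table`; `machine_pIsWellFormed` (Bernstein–Vazirani well formed, from the
  unitarity of `turn`), `machine_amplitudes_subset` (amplitudes: values of `turn`, `0`, `1`);
* `QTM.SweepSpec.pass_spec` — a pass over a stretch of live cells is the list scan `QTM.scan` of
  the rule (deterministic, by `QTM.ofRule_pevolve_single_of_classical`), the cells being
  described by absolute contents (`QTM.paintDir` over `QTM.PCfg.cells`);
* `QTM.SweepSpec.sweep_spec_gen` / `sweep_spec` / `sweep0_spec` — one full sweep from a sweep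
  boundary: R-pass, marker push, the unitary turn (a superposition over the register), L-pass,
  marker push; as an identity `pevolve^[2w+5] (single (bdryCfg p φ cs) a) =
  ∑_ψ single (bdryCfg (p-1) (sweepOut … ψ)) (a · turnAmp φ cs ψ)`;
* `QTM.SweepSpec.pstateAt_sweepTime` — **the run theorem**: the positioned superposition at the
  `(s+1)`-st sweep boundary is the image under the injective boundary encoding
  `bdryCfg (-(s+1))` (`bdryCfg_injective`) of the sweep run `dynRun x (s+1)`, the iterate of
  the finite-dimensional *sweep dynamics* `dynStep` on `Φ × List C`;
* `QTM.SweepSpec.oblivious_sweepTime` — at sweep boundaries all configurations in the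
  superposition have the same head position (BV App. B Def. B.5), so that the tree's acceptance
  probability agrees with Bernstein–Vazirani's there (`QTM.acceptProbAt_eq_pacceptProbAt`);
* `QTM.SweepSpec.pacceptProbAt_sweepTime`, `acceptProbAt_sweepTime` — the acceptance probability
  at a sweep boundary (positioned, and the tree's) is the weight, in the sweep run, of the
  register values equal to the accepting value `φa`.

No named fact is introduced. Consumers: the register/queue tracks and the quantum stack machine
of the sequel files (towards `BQP ⊆ BQPQTM`, Nishimura–Ozawa 2002 Lemma 5.1, and
Adleman–DeMarrais–Huang 1997 Cor. 3.2).

## References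

* E. Bernstein, U. Vazirani, *Quantum complexity theory*, SIAM J. Comput. 26 (1997) 1411–1473
  [BernsteinVaziraniSICOMP1997]: Def. 3.2–3.4, Def. 3.14, §4 (Thm. 4.3, Lemmas 4.4–4.13:
  reversal, looping with moving end markers), Thm. 5.3, App. B (Def. B.1, Cor. B.2, Def. B.5).
* H. Nishimura, M. Ozawa, *Computational complexity of uniform quantum circuit families and
  quantum Turing machines*, Theoret. Comput. Sci. 276 (2002) 147–181 [NishimuraOzawa2002]:
  Lemma 5.1 (QTMs carry out uniform circuit families; stationary, data-independent head motion).
-/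

noncomputable section

namespace Literature.Computability.Cryptography

namespace QTM

open Turing
open scoped BigOperators ComplexConjugate

/-! ### Cells and motions -/

/-- The non-blank tape symbols of a sweep machine over the live-cell alphabet `C`: the two end
markers of the work region and live cells (Bernstein–Vazirani 1997, §4: end markers delimiting
the region swept by looping/reversal constructions). [cite: BernsteinVaziraniSICOMP1997, §4 (Lemmas 4.4–4.13)] -/
inductive SCell (C : Type) where
  /-- left end marker of the work region -/
  | endL : SCell C
  /-- right end marker of the work region -/
  | endR : SCell C
  /-- a live cell -/
  | live (c : C) : SCell C
  deriving DecidableEq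

namespace SCell

variable {C : Type}

/-- `SCell C ≃ Option (Option C)`-style coding used for the `Fintype` instance. [folklore] -/
def toSum : SCell C → Bool ⊕ C
  | endL => Sum.inl false
  | endR => Sum.inl true
  | live c => Sum.inr c

/-- Inverse coding. [folklore] -/
def ofSum : Bool ⊕ C → SCell C
  | Sum.inl false => endL
  | Sum.inl true => endR
  | Sum.inr c => live c

/-- The coding is a bijection. [folklore] -/
def equivSum : SCell C ≃ Bool ⊕ C where
  toFun := toSum
  invFun := ofSum
  left_inv x := by cases x <;> rfl
  right_inv x := by rcases x with (_ | _) | _ <;> rfl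

/-- `SCell C` is finite for finite `C`. [folklore] -/
instance [Fintype C] : Fintype (SCell C) := Fintype.ofEquiv _ equivSum.symm

/-- `live` is injective. [folklore] -/
theorem live_injective : Function.Injective (live : C → SCell C) := fun _ _ h => by cases h; rfl

end SCell

/-- The motion component of the control state of a sweep machine: sweeping right, pushing the
right marker (one step), sweeping left, pushing the left marker (Bernstein–Vazirani 1997, §4;
each motion is entered from one direction only, Def. 3.14). [cite: BernsteinVaziraniSICOMP1997, Def. 3.14 and §4] -/
inductive Motion where
  | sweepR | pushR | sweepL | pushL
  deriving DecidableEq, Fintype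

namespace Motion

/-- The direction with which each motion state is entered: `sweepR`/`pushR` moving right,
`sweepL`/`pushL` moving left (unidirectionality, BV Def. 3.14). [cite: BernsteinVaziraniSICOMP1997, Def. 3.14] -/
def dir : Motion → Dir
  | sweepR => Dir.right
  | pushR => Dir.right
  | sweepL => Dir.left
  | pushL => Dir.left

/-- `sweepR` is entered moving right. [folklore] -/
@[simp] theorem dir_sweepR : dir sweepR = Dir.right := rfl
/-- `pushR` is entered moving right. [folklore] -/
@[simp] theorem dir_pushR : dir pushR = Dir.right := rfl
/-- `sweepL` is entered moving left. [folklore] -/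
@[simp] theorem dir_sweepL : dir sweepL = Dir.left := rfl
/-- `pushL` is entered moving left. [folklore] -/
@[simp] theorem dir_pushL : dir pushL = Dir.left := rfl

end Motion

/-! ### Sweep specifications and their machines -/

/-- **A sweep specification**: a finite control register `Φ` with start value `φ₀` and accepting
value `φa`, a finite live-cell alphabet `C` with the input coding `inp`, the padding cell `pad`
and the two anchor cells written on the first sweep (`pad ≠ anchorR`, `pad ≠ anchorL` keep the
transition table one-to-one), the classical reversible cell rules of the two passes
(`ruleR`, `ruleL`, bijections of `Φ × C`; Bernstein–Vazirani 1997, App. B: reversible = one-to-one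
transition function) and the unitary `turn` acting on the register at the right turn. [cite: BernsteinVaziraniSICOMP1997, §4 and App. B] -/
structure SweepSpec where
  /-- the control register -/
  Φ : Type
  /-- the live-cell alphabet -/
  C : Type
  [finΦ : Fintype Φ]
  [decΦ : DecidableEq Φ]
  [finC : Fintype C]
  [decC : DecidableEq C]
  /-- initial register value -/
  φ₀ : Φ
  /-- accepting register value (observed together with the motion `sweepR`) -/
  φa : Φ
  /-- input bits as live cells -/
  inp : Bool → C
  /-- the padding cell left behind when a marker moves out -/
  pad : C
  /-- the cell written at the left end on the first sweep -/
  anchorL : C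
  /-- the cell written at the right end on the first sweep -/
  anchorR : C
  pad_ne_anchorL : pad ≠ anchorL
  pad_ne_anchorR : pad ≠ anchorR
  /-- the cell rule of the rightward pass -/
  ruleR : Φ × C ≃ Φ × C
  /-- the cell rule of the leftward pass -/
  ruleL : Φ × C ≃ Φ × C
  /-- the unitary applied to the register at the right turn -/
  turn : Φ → Φ → ℂ
  turn_unitary : ∀ φ ψ : Φ, ∑ χ : Φ, conj (turn φ χ) * turn ψ χ = if φ = ψ then 1 else 0

attribute [instance] SweepSpec.finΦ SweepSpec.decΦ SweepSpec.finC SweepSpec.decC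

namespace SweepSpec

variable (S : SweepSpec)

/-- Control states of the sweep machine: motion × register. [cite: BernsteinVaziraniSICOMP1997, §4] -/
abbrev Λ' : Type := Motion × S.Φ

/-- Tape alphabet of the sweep machine: blank (`none`), end markers, live cells. [cite: BernsteinVaziraniSICOMP1997, §4] -/
abbrev Γ' : Type := Option (SCell S.C)

/-- Directions: by the motion component (unidirectional, BV Def. 3.14). [cite: BernsteinVaziraniSICOMP1997, Def. 3.14] -/
def dir' (l : S.Λ') : Dir := l.1.dir

/-- **The transition table** of the sweep machine as an injective partial function on
(control state, scanned symbol) (Bernstein–Vazirani 1997, App. B, Def. B.1): rightward pass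
(`ruleR` on live cells), the right turn in two steps (marker cell ↦ `pad`/`anchorR`, then the
blank beyond ↦ marker), leftward pass (`ruleL`), the left turn likewise. Unlisted pairs never
occur in a run and are completed arbitrarily (`QTM.completeRule`). [cite: BernsteinVaziraniSICOMP1997, §4 and App. B (Def. B.1)] -/
def table : S.Λ' × S.Γ' → Option (S.Λ' × S.Γ')
  -- rightward pass over a live cell
  | ((Motion.sweepR, φ), some (SCell.live c)) =>
      some ((Motion.sweepR, (S.ruleR (φ, c)).1), some (SCell.live (S.ruleR (φ, c)).2))
  -- right turn, step 1: the marker cell becomes a pad cell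
  | ((Motion.sweepR, φ), some SCell.endR) => some ((Motion.pushR, φ), some (SCell.live S.pad))
  -- right turn on the first sweep: the first blank becomes the right anchor
  | ((Motion.sweepR, φ), none) => some ((Motion.pushR, φ), some (SCell.live S.anchorR))
  -- right turn, step 2: write the marker on the blank beyond and turn (the unitary acts here)
  | ((Motion.pushR, φ), none) => some ((Motion.sweepL, φ), some SCell.endR)
  -- leftward pass over a live cell
  | ((Motion.sweepL, φ), some (SCell.live c)) =>
      some ((Motion.sweepL, (S.ruleL (φ, c)).1), some (SCell.live (S.ruleL (φ, c)).2))
  -- left turn, step 1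
  | ((Motion.sweepL, φ), some SCell.endL) => some ((Motion.pushL, φ), some (SCell.live S.pad))
  -- left turn on the first sweep: the first blank becomes the left anchor
  | ((Motion.sweepL, φ), none) => some ((Motion.pushL, φ), some (SCell.live S.anchorL))
  -- left turn, step 2
  | ((Motion.pushL, φ), none) => some ((Motion.sweepR, φ), some SCell.endL)
  | _ => none

/-- A partial left inverse of the transition table (used to prove that the table is one-to-one). [folklore] -/
def untable : S.Λ' × S.Γ' → Option (S.Λ' × S.Γ')
  | ((Motion.sweepR, ψ), some (SCell.live c)) =>
      some ((Motion.sweepR, (S.ruleR.symm (ψ, c)).1), some (SCell.live (S.ruleR.symm (ψ, c)).2))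
  | ((Motion.sweepR, ψ), some SCell.endL) => some ((Motion.pushL, ψ), none)
  | ((Motion.pushR, ψ), some (SCell.live c)) =>
      if c = S.pad then some ((Motion.sweepR, ψ), some SCell.endR)
      else if c = S.anchorR then some ((Motion.sweepR, ψ), none) else none
  | ((Motion.sweepL, ψ), some SCell.endR) => some ((Motion.pushR, ψ), none)
  | ((Motion.sweepL, ψ), some (SCell.live c)) =>
      some ((Motion.sweepL, (S.ruleL.symm (ψ, c)).1), some (SCell.live (S.ruleL.symm (ψ, c)).2))
  | ((Motion.pushL, ψ), some (SCell.live c)) =>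
      if c = S.pad then some ((Motion.sweepL, ψ), some SCell.endL)
      else if c = S.anchorL then some ((Motion.sweepL, ψ), none) else none
  | _ => none

/-- `untable` inverts `table` on its domain. [folklore] -/
theorem untable_of_table {x a : S.Λ' × S.Γ'} (h : S.table x = some a) : S.untable a = some x := by
  obtain ⟨⟨m, φ⟩, γ⟩ := x
  rcases m with _ | _ | _ | _ <;> rcases γ with _ | (_ | _ | c) <;>
    simp only [table, reduceCtorEq, Option.some.injEq] at h <;> subst h <;>
    simp [untable, S.pad_ne_anchorR.symm, S.pad_ne_anchorL.symm]

/-- The transition table is one-to-one (Bernstein–Vazirani 1997, App. B: reversibility). [cite: BernsteinVaziraniSICOMP1997, App. B (Def. B.1, Cor. B.2)] -/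
theorem table_injective : PartialInjective S.table := by
  intro x y a hx hy
  have h := (S.untable_of_table hx).symm.trans (S.untable_of_table hy)
  exact Option.some.inj h

/-- The register part of a control state. [folklore] -/
abbrev reg (l : S.Λ') : S.Φ := l.2

/-- The (state, symbol) pairs at which the unitary acts: motion `pushR` reading a blank (the
second step of the right turn). [cite: BernsteinVaziraniSICOMP1997, §4] -/
def InTurn (x : S.Λ' × S.Γ') : Prop := x.1.1 = Motion.pushR ∧ x.2 = none

/-- Being a turn pair is decidable. [folklore] -/
instance : DecidablePred S.InTurn := fun x => by unfold InTurn; infer_instance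

/-- The turn pair with register value `ψ`. [folklore] -/
def turnPair (ψ : S.Φ) : S.Λ' × S.Γ' := ((Motion.pushR, ψ), none)

/-- `turnPair` is injective. [folklore] -/
theorem turnPair_injective : Function.Injective S.turnPair := by
  intro ψ ψ' h
  simpa [turnPair] using h

/-- The turn pairs are exactly the values of `turnPair`. [folklore] -/
theorem inTurn_iff (x : S.Λ' × S.Γ') : S.InTurn x ↔ x = S.turnPair x.1.2 := by
  obtain ⟨⟨m, φ⟩, γ⟩ := x
  simp only [InTurn, turnPair, Prod.mk.injEq, and_true]

/-- `turnPair ψ` is a turn pair. [folklore] -/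
@[simp] theorem inTurn_turnPair (ψ : S.Φ) : S.InTurn (S.turnPair ψ) := ⟨rfl, rfl⟩

/-- **The pre-unitary of the sweep machine**: the unitary `turn` on the register at the turn
pairs, the identity on all other (state, symbol) pairs (Bernstein–Vazirani 1997, remark after
Thm. 5.3: the local matrix of a unidirectional machine). [cite: BernsteinVaziraniSICOMP1997, Thm. 5.3 (remark, p. 1434)] -/
def amp (x z : S.Λ' × S.Γ') : ℂ :=
  if S.InTurn x then (if S.InTurn z then S.turn x.1.2 z.1.2 else 0) else (if z = x then 1 else 0)

/-- A sum over all (state, symbol) pairs of a function supported on the turn pairs is a sum over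
the register. [folklore] -/
theorem sum_inTurn {β : Type*} [AddCommMonoid β] (f : S.Λ' × S.Γ' → β) :
    ∑ z : S.Λ' × S.Γ', (if S.InTurn z then f z else 0) = ∑ ψ : S.Φ, f (S.turnPair ψ) := by
  classical
  rw [← Finset.sum_filter]
  refine Finset.sum_nbij' (fun z => z.1.2) (fun ψ => S.turnPair ψ) (by simp) (by simp)
    (fun z hz => ?_) (fun ψ _ => rfl) (fun z hz => ?_)
  · exact ((S.inTurn_iff z).1 (Finset.mem_filter.1 hz).2).symm
  · rw [← (S.inTurn_iff z).1 (Finset.mem_filter.1 hz).2]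

/-- The pre-unitary of the sweep machine is unitary (its rows are orthonormal), because `turn`
is. [cite: BernsteinVaziraniSICOMP1997, Thm. 5.3] -/
theorem amp_isRowOrthonormal : IsRowOrthonormal S.amp := by
  classical
  intro x y
  by_cases hx : S.InTurn x <;> by_cases hy : S.InTurn y
  · -- both turn pairs: unitarity of `turn`
    have hx' := (S.inTurn_iff x).1 hx
    have hy' := (S.inTurn_iff y).1 hy
    calc ∑ z, conj (S.amp x z) * S.amp y z
        = ∑ z : S.Λ' × S.Γ', (if S.InTurn z then conj (S.turn x.1.2 z.1.2) * S.turn y.1.2 z.1.2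
            else 0) := Finset.sum_congr rfl fun z _ => by
              unfold amp; by_cases hz : S.InTurn z <;> simp [hx, hy, hz]
      _ = ∑ ψ : S.Φ, conj (S.turn x.1.2 ψ) * S.turn y.1.2 ψ := S.sum_inTurn _
      _ = if x.1.2 = y.1.2 then 1 else 0 := by simpa [turnPair] using S.turn_unitary x.1.2 y.1.2
      _ = if x = y then 1 else 0 := by
          by_cases h : x = y
          · simp [h]
          · rw [if_neg h, if_neg]
            intro h'
            exact h (hx'.trans ((congrArg S.turnPair h').trans hy'.symm))
  · -- x turn, y not: the row of `y` is the basis vector of `y`, on which the row of `x` vanishes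
    have hxy : x ≠ y := fun h => hy (h ▸ hx)
    rw [if_neg hxy]
    calc ∑ z, conj (S.amp x z) * S.amp y z = ∑ z, (if z = y then conj (S.amp x z) else 0) :=
          Finset.sum_congr rfl fun z _ => by unfold amp; by_cases hz : z = y <;> simp [hy, hz]
      _ = conj (S.amp x y) := by rw [Finset.sum_ite_eq' Finset.univ y]; simp
      _ = 0 := by unfold amp; simp [hx, hy]
  · have hxy : x ≠ y := fun h => hx (h ▸ hy)
    rw [if_neg hxy]
    calc ∑ z, conj (S.amp x z) * S.amp y z = ∑ z, (if z = x then S.amp y z else 0) :=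
          Finset.sum_congr rfl fun z _ => by unfold amp; by_cases hz : z = x <;> simp [hx, hz]
      _ = S.amp y x := by rw [Finset.sum_ite_eq' Finset.univ x]; simp
      _ = 0 := by unfold amp; simp [hy, hx]
  · calc ∑ z, conj (S.amp x z) * S.amp y z = ∑ z, (if z = x then S.amp y z else 0) :=
          Finset.sum_congr rfl fun z _ => by unfold amp; by_cases hz : z = x <;> simp [hx, hz]
      _ = S.amp y x := by rw [Finset.sum_ite_eq' Finset.univ x]; simp
      _ = if x = y then 1 else 0 := by
          unfold amp; by_cases h : x = y <;> simp [hy, h]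

/-- The values of the pre-unitary are `0`, `1` or values of `turn`. [folklore] -/
theorem amp_mem (x z : S.Λ' × S.Γ') :
    S.amp x z ∈ insert (0 : ℂ) (insert 1 (Set.range fun p : S.Φ × S.Φ => S.turn p.1 p.2)) := by
  unfold amp
  split_ifs
  · exact Or.inr (Or.inr ⟨(x.1.2, z.1.2), rfl⟩)
  · exact Or.inl rfl
  · exact Or.inr (Or.inl rfl)
  · exact Or.inl rfl

/-- **The sweep machine** of the specification `S` (an instance of `QTM.ofRule`): start state
`(sweepR, φ₀)` with the head on the first input cell, accepting state `(sweepR, φa)`, input bits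
as live cells, directions by motion, the pre-unitary `S.amp` and the completed transition table.
[cite: BernsteinVaziraniSICOMP1997, §4 and App. B (Cor. B.2)] -/
abbrev machine : QTM :=
  ofRule ((Motion.sweepR, S.φ₀) : S.Λ') (Motion.sweepR, S.φa)
    (fun b => (some (SCell.live (S.inp b)) : S.Γ')) S.dir' S.amp (completeRule S.table S.table_injective)

/-- The sweep machine is well formed in the tree's model. [cite: BernsteinVaziraniSICOMP1997, Thm. 5.3] -/
theorem machine_isWellFormed : S.machine.IsWellFormed :=
  ofRule_isWellFormed _ _ _ _ _ _ S.amp_isRowOrthonormal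

/-- **The sweep machine is Bernstein–Vazirani well formed** (positioned model). [cite: BernsteinVaziraniSICOMP1997, Def. 3.3 and Thm. 5.3] -/
theorem machine_pIsWellFormed : S.machine.PIsWellFormed :=
  ofRule_pIsWellFormed _ _ _ _ _ _ S.amp_isRowOrthonormal ⟨some SCell.endL, Option.some_ne_none _⟩

/-- **Amplitudes of the sweep machine**: `0`, `1` and the entries of the turn unitary (for
`BQPQTMWith S` / `BQPQTMPosWith S` it suffices that `S ∋ 0, 1` and contains the entries of
`turn`). [cite: BernsteinVaziraniSICOMP1997, §6 (amplitude sets)] -/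
theorem machine_amplitudes_subset {T : Set ℂ} (h0 : (0 : ℂ) ∈ T) (h1 : (1 : ℂ) ∈ T)
    (hturn : ∀ φ ψ, S.turn φ ψ ∈ T) : S.machine.amplitudes ⊆ T := by
  refine ofRule_amplitudes_subset_of _ _ _ _ _ _ h0 fun x z => ?_
  rcases S.amp_mem x z with h | h | ⟨p, hp⟩
  · rw [h]; exact h0
  · rw [h]; exact h1
  · rw [← hp]; exact hturn p.1 p.2

/-! ### Single steps of the sweep machine -/

/-- The bijection of the sweep machine agrees with the table on the table's domain. [cite: BernsteinVaziraniSICOMP1997, App. B (Cor. B.2)] -/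
theorem perm_apply {x a : S.Λ' × S.Γ'} (h : S.table x = some a) :
    completeRule S.table S.table_injective x = a :=
  completeRule_apply S.table_injective h

/-- **A classical step**: at a (state, symbol) pair in the table's domain other than a turn pair
the machine moves deterministically as the table says. [cite: BernsteinVaziraniSICOMP1997, App. B] -/
theorem step_classical (c : S.machine.PCfg) (a : ℂ) {y : S.Λ' × S.Γ'}
    (ht : S.table (c.1.q, c.1.tape.head) = some y) (hcl : ¬ S.InTurn (c.1.q, c.1.tape.head)) :
    S.machine.pevolve (Finsupp.single c a) =
      Finsupp.single (detTarget _ _ _ S.dir' S.amp (completeRule S.table S.table_injective) c y) a := by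
  unfold machine
  rw [ofRule_pevolve_single_of_classical _ _ _ _ _ _ c a (fun z => by unfold amp; rw [if_neg hcl]),
    S.perm_apply ht]

/-- **The quantum step** (second step of the right turn): in motion `pushR` reading a blank, the
register goes into the superposition prescribed by `turn`, the right marker is written and the
head turns left. [cite: BernsteinVaziraniSICOMP1997, §4] -/
theorem step_turn (c : S.machine.PCfg) (a : ℂ) (φ : S.Φ)
    (hq : c.1.q = (Motion.pushR, φ)) (hhead : c.1.tape.head = none) :
    S.machine.pevolve (Finsupp.single c a) =
      ∑ ψ : S.Φ, (a * S.turn φ ψ) • Finsupp.single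
        (detTarget _ _ _ S.dir' S.amp (completeRule S.table S.table_injective) c
          ((Motion.sweepL, ψ), some SCell.endR)) (1 : ℂ) := by
  have hx : S.InTurn (c.1.q, c.1.tape.head) := ⟨by rw [hq], hhead⟩
  unfold machine
  rw [ofRule_pevolve_single]
  have hamp : ∀ z, S.amp (c.1.q, c.1.tape.head) z = if S.InTurn z then S.turn φ z.1.2 else 0 := by
    intro z; unfold amp; rw [if_pos hx, hq]
  simp_rw [hamp]
  have key := S.sum_inTurn (fun z => (a * S.turn φ z.1.2) •
    Finsupp.single (detTarget _ _ _ S.dir' S.amp (completeRule S.table S.table_injective) c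
      (completeRule S.table S.table_injective z)) (1 : ℂ))
  simp only [mul_ite, mul_zero, ite_smul, zero_smul] at key ⊢
  rw [key]
  refine Finset.sum_congr rfl fun ψ _ => ?_
  rw [S.perm_apply (show S.table (S.turnPair ψ) = some ((Motion.sweepL, ψ), some SCell.endR) from rfl)]
  rfl

/-! ### Painting cell contents and scanning lists -/

section Paint

variable {Γ : Type*}

/-- Painting the list `l` onto the cell function `g` from position `p` in direction `d`
(`d = 1`: cells `p, p+1, …`; `d = -1`: cells `p, p-1, …`). [folklore] -/
def paintDir (d : ℤ) : (ℤ → Γ) → ℤ → List Γ → (ℤ → Γ)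
  | g, _, [] => g
  | g, p, x :: xs => paintDir d (Function.update g p x) (p + d) xs

/-- Painting the empty list changes nothing. [folklore] -/
@[simp] theorem paintDir_nil (d : ℤ) (g : ℤ → Γ) (p : ℤ) : paintDir d g p [] = g := rfl

/-- Painting a cons: update the first cell and go on. [folklore] -/
@[simp] theorem paintDir_cons (d : ℤ) (g : ℤ → Γ) (p : ℤ) (x : Γ) (xs : List Γ) :
    paintDir d g p (x :: xs) = paintDir d (Function.update g p x) (p + d) xs := rfl

/-- Cells behind the starting position are not painted. [folklore] -/
theorem paintDir_apply_of_behind {d : ℤ} (hd : d = 1 ∨ d = -1) (g : ℤ → Γ) (p : ℤ) (l : List Γ)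
    {q : ℤ} (hq : d * (q - p) < 0) : paintDir d g p l q = g q := by
  induction l generalizing g p with
  | nil => rfl
  | cons x xs ih =>
    rw [paintDir_cons, ih _ _ (by rcases hd with rfl | rfl <;> nlinarith), Function.update_of_ne]
    rintro rfl
    simp at hq

/-- Updating a cell behind the starting position commutes with painting. [folklore] -/
theorem update_paintDir_of_behind {d : ℤ} (hd : d = 1 ∨ d = -1) (g : ℤ → Γ) (p : ℤ) (l : List Γ)
    {q : ℤ} (hq : d * (q - p) < 0) (y : Γ) :
    Function.update (paintDir d g p l) q y = paintDir d (Function.update g q y) p l := by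
  induction l generalizing g p with
  | nil => rfl
  | cons x xs ih =>
    have hqp : q ≠ p := by rintro rfl; simp at hq
    rw [paintDir_cons, paintDir_cons, ih _ _ (by rcases hd with rfl | rfl <;> nlinarith),
      Function.update_comm hqp]

/-- Painting a concatenation. [folklore] -/
theorem paintDir_append (d : ℤ) (g : ℤ → Γ) (p : ℤ) (l l' : List Γ) :
    paintDir d g p (l ++ l') = paintDir d (paintDir d g p l) (p + d * l.length) l' := by
  induction l generalizing g p with
  | nil => simp
  | cons x xs ih =>
    rw [List.cons_append, paintDir_cons, ih, paintDir_cons]; congr 1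
    simp only [List.length_cons]; push_cast; ring

/-- Updating a cell beyond a rightward-painted stretch commutes with painting. [folklore] -/
theorem update_paintDir_one_of_le (g : ℤ → Γ) (p : ℤ) (l : List Γ) {q : ℤ} (hq : p + l.length ≤ q)
    (y : Γ) : Function.update (paintDir 1 g p l) q y = paintDir 1 (Function.update g q y) p l := by
  induction l generalizing g p with
  | nil => rfl
  | cons x xs ih =>
    simp only [List.length_cons, Nat.cast_add, Nat.cast_one] at hq
    have hqp : q ≠ p := by rintro rfl; linarith
    rw [paintDir_cons, paintDir_cons, ih _ _ (by linarith), Function.update_comm hqp]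

/-- Painting leftwards from `p` is painting the reversed list rightwards from `p - (len - 1)`. [folklore] -/
theorem paintDir_neg_one_eq (g : ℤ → Γ) (p : ℤ) (l : List Γ) :
    paintDir (-1) g p l = paintDir 1 g (p - l.length + 1) l.reverse := by
  induction l generalizing g p with
  | nil => simp
  | cons x xs ih =>
    rw [paintDir_cons, ih, List.reverse_cons, paintDir_append, List.length_reverse, List.length_cons]
    have h1 : p - (↑(xs.length + 1) : ℤ) + 1 + 1 * ↑xs.length = p := by push_cast; ring
    have h2 : p + -1 - (↑xs.length : ℤ) + 1 = p - ↑xs.length := by ring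
    have h3 : p - (↑(xs.length + 1) : ℤ) + 1 = p - ↑xs.length := by push_cast; ring
    rw [h1, h2, h3, paintDir_cons, paintDir_nil, update_paintDir_one_of_le _ _ _ (by simp)]

/-- Painted cells: the cell at offset `i < len` holds the `i`-th entry. [folklore] -/
theorem paintDir_one_apply_of_lt (g : ℤ → Γ) (p : ℤ) (l : List Γ) (i : ℕ) (hi : i < l.length) :
    paintDir 1 g p l (p + i) = l[i] := by
  induction l generalizing g p i with
  | nil => simp at hi
  | cons x xs ih =>
    rw [paintDir_cons]
    rcases i with _ | i
    · simp only [Nat.cast_zero, add_zero, List.getElem_cons_zero]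
      rw [paintDir_apply_of_behind (Or.inl rfl) _ _ _ (by linarith), Function.update_self]
    · have := ih (Function.update g p x) (p + 1) i (by simpa using hi)
      rw [show p + 1 + (i : ℤ) = p + ↑(i + 1) by push_cast; ring] at this
      rw [this, List.getElem_cons_succ]

/-- Cells beyond the painted stretch are not painted. [folklore] -/
theorem paintDir_one_apply_of_le (g : ℤ → Γ) (p : ℤ) (l : List Γ) {q : ℤ} (hq : p + l.length ≤ q) :
    paintDir 1 g p l q = g q := by
  induction l generalizing g p with
  | nil => rfl
  | cons x xs ih =>
    simp only [List.length_cons, Nat.cast_add, Nat.cast_one] at hq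
    rw [paintDir_cons, ih _ _ (by linarith), Function.update_of_ne]
    rintro rfl; linarith

end Paint

section Scan

variable {Φ C : Type}

/-- Scanning a list with a (register, cell) rule, threading the register: the list-level effect of
one pass of a sweep machine over a stretch of live cells, in the order the head meets them. [cite: BernsteinVaziraniSICOMP1997, §4] -/
def scan (r : Φ × C → Φ × C) : Φ → List C → Φ × List C
  | φ, [] => (φ, [])
  | φ, x :: xs => ((scan r (r (φ, x)).1 xs).1, (r (φ, x)).2 :: (scan r (r (φ, x)).1 xs).2)

/-- Scanning the empty list. [folklore] -/
@[simp] theorem scan_nil (r : Φ × C → Φ × C) (φ : Φ) : scan r φ [] = (φ, []) := rfl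

/-- Scanning a cons: apply the rule, thread the register. [folklore] -/
@[simp] theorem scan_cons (r : Φ × C → Φ × C) (φ : Φ) (x : C) (xs : List C) :
    scan r φ (x :: xs) = ((scan r (r (φ, x)).1 xs).1, (r (φ, x)).2 :: (scan r (r (φ, x)).1 xs).2) :=
  rfl

/-- A scan preserves the length. [folklore] -/
@[simp] theorem length_scan (r : Φ × C → Φ × C) (φ : Φ) (l : List C) : ((scan r φ l).2).length = l.length := by
  induction l generalizing φ with
  | nil => rfl
  | cons x xs ih => simp [ih]

end Scan

/-! ### Passes of the sweep machine -/

/-- Live cells as tape symbols. [folklore] -/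
abbrev liveCell (c : S.C) : S.Γ' := some (SCell.live c)

/-- The cell rule of a pass, by motion (`sweepR` ↦ `ruleR`, `sweepL` ↦ `ruleL`). [folklore] -/
def rule : Motion → S.Φ × S.C → S.Φ × S.C
  | Motion.sweepL => S.ruleL
  | _ => S.ruleR

/-- The rule of the rightward pass is `ruleR`. [folklore] -/
@[simp] theorem rule_sweepR : S.rule Motion.sweepR = S.ruleR := rfl
/-- The rule of the leftward pass is `ruleL`. [folklore] -/
@[simp] theorem rule_sweepL : S.rule Motion.sweepL = S.ruleL := rfl

/-- The motions of the two passes. [folklore] -/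
def IsPass (m : Motion) : Prop := m = Motion.sweepR ∨ m = Motion.sweepL

/-- The table on a live cell during a pass: apply the rule, keep the motion. [cite: BernsteinVaziraniSICOMP1997, §4] -/
theorem table_live {m : Motion} (hm : IsPass m) (φ : S.Φ) (x : S.C) :
    S.table ((m, φ), S.liveCell x) = some ((m, (S.rule m (φ, x)).1), S.liveCell (S.rule m (φ, x)).2) := by
  rcases hm with rfl | rfl <;> rfl

/-- A pass pair is not a turn pair. [folklore] -/
theorem not_inTurn_live (m : Motion) (φ : S.Φ) (x : S.C) : ¬ S.InTurn ((m, φ), S.liveCell x) :=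
  fun h => Option.some_ne_none _ h.2

/-- The target configuration of a table step (abbreviation for `QTM.detTarget` at the data of the
sweep machine). [cite: BernsteinVaziraniSICOMP1997, Def. 3.2] -/
abbrev tgt (c : S.machine.PCfg) (y : S.Λ' × S.Γ') : S.machine.PCfg :=
  detTarget _ _ _ S.dir' S.amp (completeRule S.table S.table_injective) c y

/-- The position shift of a motion (`+1` for the right-moving motions, `-1` for the left-moving). [folklore] -/
def mshift (m : Motion) : ℤ := dirShift m.dir

/-- `sweepR` moves the head by `+1`. [folklore] -/
@[simp] theorem mshift_sweepR : mshift Motion.sweepR = 1 := rfl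
/-- `pushR` moves the head by `+1`. [folklore] -/
@[simp] theorem mshift_pushR : mshift Motion.pushR = 1 := rfl
/-- `sweepL` moves the head by `-1`. [folklore] -/
@[simp] theorem mshift_sweepL : mshift Motion.sweepL = -1 := rfl
/-- `pushL` moves the head by `-1`. [folklore] -/
@[simp] theorem mshift_pushL : mshift Motion.pushL = -1 := rfl

/-- A pass moves the head by `±1`. [folklore] -/
theorem mshift_eq_of_isPass {m : Motion} (hm : IsPass m) : mshift m = 1 ∨ mshift m = -1 := by
  rcases hm with rfl | rfl
  · exact Or.inl rfl
  · exact Or.inr rfl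

/-- State, position and cells of a table-step target. [cite: NishimuraOzawa2002, §2] -/
theorem tgt_q (c : S.machine.PCfg) (y : S.Λ' × S.Γ') : (S.tgt c y).1.q = y.1 := rfl

/-- The head position of a table-step target. [cite: NishimuraOzawa2002, §2] -/
theorem tgt_snd (c : S.machine.PCfg) (y : S.Λ' × S.Γ') : (S.tgt c y).2 = c.2 + mshift y.1.1 := rfl

/-- The cells of a table-step target: the head cell is overwritten. [cite: NishimuraOzawa2002, §2] -/
theorem cells_tgt (c : S.machine.PCfg) (y : S.Λ' × S.Γ') :
    PCfg.cells (S.tgt c y) = Function.update (PCfg.cells c) c.2 y.2 :=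
  cells_detTarget _ _ _ _ _ _ c y

/-- The configuration at the end of a pass over the live cells `l` (met in this order), by
iterating table-step targets. [cite: BernsteinVaziraniSICOMP1997, §4] -/
def pass (m : Motion) : S.machine.PCfg → S.Φ → List S.C → S.machine.PCfg
  | c, _, [] => c
  | c, φ, x :: xs => pass m (S.tgt c ((m, (S.rule m (φ, x)).1), S.liveCell (S.rule m (φ, x)).2))
      (S.rule m (φ, x)).1 xs

/-- The scanned symbol of a positioned configuration is its cell at the head position. [folklore] -/
theorem head_eq_cells (c : S.machine.PCfg) : c.1.tape.head = PCfg.cells c c.2 :=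
  (PCfg.cells_snd c).symm

/-- **A pass of the sweep machine** (Bernstein–Vazirani 1997, §4; the deterministic stretches of
Nishimura–Ozawa's Lemma 5.1 machine): started in a pass motion `m` with register `φ` on cells
painted with the live list `l` ahead of the head (in direction `mshift m`), after exactly
`l.length` steps the machine is, with amplitude unchanged, in the configuration `pass m c φ l`:
motion `m`, register and cells given by the list scan `scan (rule m) φ l`, head just beyond the
stretch. [cite: BernsteinVaziraniSICOMP1997, §4 (Lemmas 4.4–4.13)] -/
theorem pass_spec {m : Motion} (hm : IsPass m) (l : List S.C) :
    ∀ (c : S.machine.PCfg) (φ : S.Φ) (g : ℤ → S.Γ') (a : ℂ),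
      c.1.q = (m, φ) → PCfg.cells c = paintDir (mshift m) g c.2 (l.map S.liveCell) →
        S.machine.pevolve^[l.length] (Finsupp.single c a) = Finsupp.single (S.pass m c φ l) a ∧
        (S.pass m c φ l).1.q = (m, (scan (S.rule m) φ l).1) ∧
        (S.pass m c φ l).2 = c.2 + mshift m * l.length ∧
        PCfg.cells (S.pass m c φ l) = paintDir (mshift m) g c.2 ((scan (S.rule m) φ l).2.map S.liveCell) := by
  have hd := mshift_eq_of_isPass hm
  induction l with
  | nil =>
    intro c φ g a hq hc
    simpa [pass] using ⟨hq, hc⟩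
  | cons x xs ih =>
    intro c φ g a hq hc
    -- the scanned symbol is the first live cell
    have hhead : c.1.tape.head = S.liveCell x := by
      rw [head_eq_cells, hc, List.map_cons, paintDir_cons,
        paintDir_apply_of_behind hd _ _ _ (by rcases hd with h | h <;> simp [h]), Function.update_self]
    set y : S.Λ' × S.Γ' := ((m, (S.rule m (φ, x)).1), S.liveCell (S.rule m (φ, x)).2) with hy
    have ht : S.table (c.1.q, c.1.tape.head) = some y := by rw [hq, hhead]; exact S.table_live hm φ x
    have hstep : S.machine.pevolve (Finsupp.single c a) = Finsupp.single (S.tgt c y) a :=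
      S.step_classical c a ht (by rw [hq, hhead]; exact S.not_inTurn_live m φ x)
    -- the target satisfies the hypotheses for the tail
    have hq' : (S.tgt c y).1.q = (m, (S.rule m (φ, x)).1) := rfl
    have hc' : PCfg.cells (S.tgt c y) =
        paintDir (mshift m) (Function.update g c.2 (S.liveCell (S.rule m (φ, x)).2)) (S.tgt c y).2
          (xs.map S.liveCell) := by
      rw [cells_tgt, hc, List.map_cons, paintDir_cons, tgt_snd,
        update_paintDir_of_behind hd _ _ _ (by rcases hd with h | h <;> simp [h]), Function.update_idem]
    obtain ⟨h1, h2, h3, h4⟩ := ih (S.tgt c y) _ _ a hq' hc'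
    refine ⟨?_, ?_, ?_, ?_⟩
    · rw [List.length_cons, Function.iterate_succ_apply, hstep, h1]; rfl
    · rw [pass, h2, scan_cons]
    · rw [pass, h3, tgt_snd, List.length_cons]; push_cast; ring
    · rw [pass, h4, scan_cons, List.map_cons, paintDir_cons, tgt_snd]

/-! ### Linearity of iterated evolution -/

/-- The positioned evolution as an additive map. [cite: BernsteinVaziraniSICOMP1997, Def. 3.2] -/
def pevolveHom (M : QTM) : (M.PCfg →₀ ℂ) →+ (M.PCfg →₀ ℂ) where
  toFun := M.pevolve
  map_zero' := by unfold pevolve pevolveWith; exact Finsupp.sum_zero_index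
  map_add' := M.pevolveWith_add M.δ

/-- `pevolveHom` is `pevolve`. [folklore] -/
@[simp] theorem pevolveHom_apply (M : QTM) (ψ : M.PCfg →₀ ℂ) : pevolveHom M ψ = M.pevolve ψ := rfl

/-- Iterated evolution is additive over finite sums. [cite: BernsteinVaziraniSICOMP1997, Def. 3.2] -/
theorem iterate_pevolve_finset_sum (M : QTM) {ι : Type*} (k : ℕ) (t : Finset ι) (f : ι → M.PCfg →₀ ℂ) :
    M.pevolve^[k] (∑ i ∈ t, f i) = ∑ i ∈ t, M.pevolve^[k] (f i) := by
  induction k generalizing f with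
  | zero => rfl
  | succ k ih =>
    simp only [Function.iterate_succ_apply]
    rw [show M.pevolve (∑ i ∈ t, f i) = ∑ i ∈ t, M.pevolve (f i) from map_sum (pevolveHom M) f t]
    exact ih _

/-- Iterated evolution is additive over `Finsupp.sum`. [cite: BernsteinVaziraniSICOMP1997, Def. 3.2] -/
theorem iterate_pevolve_finsupp_sum (M : QTM) {α : Type*} (k : ℕ) (v : α →₀ ℂ) (f : α → ℂ → M.PCfg →₀ ℂ) :
    M.pevolve^[k] (v.sum f) = v.sum fun b a => M.pevolve^[k] (f b a) :=
  iterate_pevolve_finset_sum M k _ _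

/-! ### Configurations with prescribed cells; boundary configurations -/

/-- A positioned configuration of the sweep machine with prescribed control state, cell contents
(blank almost everywhere) and head position (faithfulness of the positioned model,
`QTM.exists_pcfg_cells_eq`). [cite: BernsteinVaziraniSICOMP1997, Def. 3.1–3.2] -/
def mkCfg (q : S.Λ') (g : ℤ → S.Γ') (hg : {z | g z ≠ default}.Finite) (ξ : ℤ) : S.machine.PCfg :=
  Classical.choose (exists_pcfg_cells_eq (M := S.machine) q g hg ξ)

/-- The control state of `mkCfg`. [folklore] -/
theorem mkCfg_q (q : S.Λ') (g : ℤ → S.Γ') (hg : {z | g z ≠ default}.Finite) (ξ : ℤ) :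
    (S.mkCfg q g hg ξ).1.q = q :=
  (Classical.choose_spec (exists_pcfg_cells_eq (M := S.machine) q g hg ξ)).1

/-- The head position of `mkCfg`. [folklore] -/
theorem mkCfg_snd (q : S.Λ') (g : ℤ → S.Γ') (hg : {z | g z ≠ default}.Finite) (ξ : ℤ) :
    (S.mkCfg q g hg ξ).2 = ξ :=
  (Classical.choose_spec (exists_pcfg_cells_eq (M := S.machine) q g hg ξ)).2.1

/-- The cells of `mkCfg`. [folklore] -/
theorem cells_mkCfg (q : S.Λ') (g : ℤ → S.Γ') (hg : {z | g z ≠ default}.Finite) (ξ : ℤ) :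
    PCfg.cells (S.mkCfg q g hg ξ) = g :=
  (Classical.choose_spec (exists_pcfg_cells_eq (M := S.machine) q g hg ξ)).2.2

/-- The background of a sweep boundary: left marker at `L`, right marker at `R`, blank elsewhere. [cite: BernsteinVaziraniSICOMP1997, §4] -/
def markerBg (L R : ℤ) (z : ℤ) : S.Γ' :=
  if z = L then some SCell.endL else if z = R then some SCell.endR else none

/-- The cell contents at a sweep boundary with the live stretch `cs` starting at `p`: left marker at
`p - 1`, the live cells, right marker at `p + |cs|`. [cite: BernsteinVaziraniSICOMP1997, §4] -/
def bdryCells (p : ℤ) (cs : List S.C) : ℤ → S.Γ' :=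
  paintDir 1 (S.markerBg (p - 1) (p + cs.length)) p (cs.map S.liveCell)

/-- Painted cell functions over a blank-almost-everywhere background are blank almost everywhere. [folklore] -/
theorem finite_paintDir_one {Γ : Type*} [Inhabited Γ] (g : ℤ → Γ) (hg : {z | g z ≠ default}.Finite)
    (p : ℤ) (l : List Γ) : {z | paintDir 1 g p l z ≠ default}.Finite := by
  induction l generalizing g p with
  | nil => exact hg
  | cons x xs ih =>
    rw [paintDir_cons]
    refine ih _ (Set.Finite.subset (hg.union (Set.finite_singleton p)) fun z hz => ?_) _
    by_cases h : z = p
    · exact Or.inr h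
    · left; simpa [Function.update_of_ne h] using hz

/-- The marker background is blank almost everywhere. [folklore] -/
theorem finite_markerBg (L R : ℤ) : {z | S.markerBg L R z ≠ default}.Finite := by
  refine Set.Finite.subset ((Set.finite_singleton L).union (Set.finite_singleton R)) fun z hz => ?_
  by_contra h
  simp only [Set.mem_union, Set.mem_singleton_iff, not_or] at h
  exact hz (by simp [markerBg, h.1, h.2]; rfl)

/-- Boundary cells are blank almost everywhere. [folklore] -/
theorem finite_bdryCells (p : ℤ) (cs : List S.C) : {z | S.bdryCells p cs z ≠ default}.Finite :=
  finite_paintDir_one _ (S.finite_markerBg _ _) _ _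

/-- **The boundary configuration** of a sweep: motion `sweepR` with register `φ`, head on the
first live cell `p`, live stretch `cs` between the markers at `p - 1` and `p + |cs|`
(Bernstein–Vazirani 1997, §4: the canonical position at which loops are re-entered). [cite: BernsteinVaziraniSICOMP1997, §4] -/
def bdryCfg (p : ℤ) (φ : S.Φ) (cs : List S.C) : S.machine.PCfg :=
  S.mkCfg (Motion.sweepR, φ) (S.bdryCells p cs) (S.finite_bdryCells p cs) p

/-- The control state of a boundary configuration. [folklore] -/
theorem bdryCfg_q (p : ℤ) (φ : S.Φ) (cs : List S.C) : (S.bdryCfg p φ cs).1.q = (Motion.sweepR, φ) :=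
  S.mkCfg_q _ _ _ _

/-- The head position of a boundary configuration. [folklore] -/
theorem bdryCfg_snd (p : ℤ) (φ : S.Φ) (cs : List S.C) : (S.bdryCfg p φ cs).2 = p := S.mkCfg_snd _ _ _ _

/-- The cells of a boundary configuration. [folklore] -/
theorem cells_bdryCfg (p : ℤ) (φ : S.Φ) (cs : List S.C) :
    PCfg.cells (S.bdryCfg p φ cs) = S.bdryCells p cs :=
  S.cells_mkCfg _ _ _ _

/-- Rightward paintings over backgrounds that agree off the painted stretch agree. [folklore] -/
theorem paintDir_one_congr {Γ : Type*} (g g' : ℤ → Γ) (p : ℤ) (l : List Γ)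
    (h : ∀ z, z < p ∨ p + l.length ≤ z → g z = g' z) : paintDir 1 g p l = paintDir 1 g' p l := by
  funext z
  rcases lt_or_ge z p with hz | hz
  · rw [paintDir_apply_of_behind (Or.inl rfl) _ _ _ (by linarith),
      paintDir_apply_of_behind (Or.inl rfl) _ _ _ (by linarith), h z (Or.inl hz)]
  rcases lt_or_ge z (p + l.length) with hz' | hz'
  · obtain ⟨i, rfl⟩ : ∃ i : ℕ, z = p + i := ⟨(z - p).toNat, by omega⟩
    have hi : i < l.length := by omega
    rw [paintDir_one_apply_of_lt _ _ _ _ hi, paintDir_one_apply_of_lt _ _ _ _ hi]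
  · rw [paintDir_one_apply_of_le _ _ _ hz', paintDir_one_apply_of_le _ _ _ hz', h z (Or.inr hz')]

/-- The boundary cells: marker / live cell / marker / blank, by position. [folklore] -/
theorem bdryCells_apply_left (p : ℤ) (cs : List S.C) : S.bdryCells p cs (p - 1) = some SCell.endL := by
  rw [bdryCells, paintDir_apply_of_behind (Or.inl rfl) _ _ _ (by linarith)]
  simp [markerBg]

/-- The right marker of the boundary cells. [folklore] -/
theorem bdryCells_apply_right (p : ℤ) (cs : List S.C) : S.bdryCells p cs (p + cs.length) = some SCell.endR := by
  rw [bdryCells, paintDir_one_apply_of_le _ _ _ (by simp)]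
  have h : (p + cs.length : ℤ) ≠ p - 1 := by omega
  simp [markerBg, h]

/-- The live cells of the boundary cells. [folklore] -/
theorem bdryCells_apply_live (p : ℤ) (cs : List S.C) (i : ℕ) (hi : i < cs.length) :
    S.bdryCells p cs (p + i) = S.liveCell cs[i] := by
  rw [bdryCells, paintDir_one_apply_of_lt _ _ _ _ (by simpa using hi)]
  simp

/-- Left of the left marker the boundary cells are blank. [folklore] -/
theorem bdryCells_apply_of_lt (p : ℤ) (cs : List S.C) {z : ℤ} (hz : z < p - 1) : S.bdryCells p cs z = none := by
  rw [bdryCells, paintDir_apply_of_behind (Or.inl rfl) _ _ _ (by linarith)]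
  have h1 : z ≠ p - 1 := by omega
  have h2 : z ≠ p + cs.length := by omega
  simp [markerBg, h1, h2]

/-- Right of the right marker the boundary cells are blank. [folklore] -/
theorem bdryCells_apply_of_gt (p : ℤ) (cs : List S.C) {z : ℤ} (hz : p + cs.length < z) :
    S.bdryCells p cs z = none := by
  rw [bdryCells, paintDir_one_apply_of_le _ _ _ (by simp; omega)]
  have h1 : z ≠ p - 1 := by omega
  have h2 : z ≠ p + cs.length := by omega
  simp [markerBg, h1, h2]

/-- **Boundary configurations determine register and live stretch** (the boundary encoding is
injective, for a fixed head position). [folklore] -/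
theorem bdryCfg_injective (p : ℤ) : Function.Injective fun b : S.Φ × List S.C => S.bdryCfg p b.1 b.2 := by
  rintro ⟨φ, cs⟩ ⟨φ', cs'⟩ h
  dsimp only at h
  have hq := congrArg (fun c => c.1.q) h
  simp only [bdryCfg_q, Prod.mk.injEq, true_and] at hq
  have hc := congrArg PCfg.cells h
  rw [cells_bdryCfg, cells_bdryCfg] at hc
  -- the lengths agree: look at the right marker of the first stretch
  have hlen : cs.length = cs'.length := by
    by_contra hne
    rcases Nat.lt_or_gt_of_ne hne with hlt | hlt
    · have h1 := congrFun hc (p + cs.length)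
      rw [bdryCells_apply_right, S.bdryCells_apply_live p cs' cs.length hlt] at h1
      exact absurd h1 (by simp [liveCell])
    · have h1 := congrFun hc (p + cs'.length)
      rw [S.bdryCells_apply_live p cs cs'.length hlt, bdryCells_apply_right] at h1
      exact absurd h1 (by simp [liveCell])
  have hcs : cs = cs' := by
    refine List.ext_getElem hlen fun i hi hi' => ?_
    have h1 := congrFun hc (p + i)
    rw [S.bdryCells_apply_live p cs i hi, S.bdryCells_apply_live p cs' i hi'] at h1
    exact SCell.live_injective (Option.some.inj h1)
  subst hq hcs
  rfl

/-! ### One full sweep -/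

/-- The delimiters of the work region met by a sweep and the cells written in their place: the
markers (all sweeps but the first; `pad` is written) or blanks (the first sweep; the anchors are
written). [cite: BernsteinVaziraniSICOMP1997, §4] -/
structure Delims where
  /-- the symbol at the left end (position `p - 1`) -/
  dl : S.Γ'
  /-- the symbol at the right end (position `p + w`) -/
  dr : S.Γ'
  /-- the live cell written at the left end -/
  padL : S.C
  /-- the live cell written at the right end -/
  padR : S.C
  table_dr : ∀ φ : S.Φ, S.table ((Motion.sweepR, φ), dr) = some ((Motion.pushR, φ), S.liveCell padR)
  table_dl : ∀ φ : S.Φ, S.table ((Motion.sweepL, φ), dl) = some ((Motion.pushL, φ), S.liveCell padL)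

/-- The delimiters of all sweeps but the first: the end markers; pads are written. [cite: BernsteinVaziraniSICOMP1997, §4] -/
def markerDelims : S.Delims where
  dl := some SCell.endL
  dr := some SCell.endR
  padL := S.pad
  padR := S.pad
  table_dr _ := rfl
  table_dl _ := rfl

/-- The delimiters of the first sweep: blanks; the anchors are written. [cite: BernsteinVaziraniSICOMP1997, §4] -/
def blankDelims : S.Delims where
  dl := none
  dr := none
  padL := S.anchorL
  padR := S.anchorR
  table_dr _ := rfl
  table_dl _ := rfl

/-- **The sweep map on register and live stretch**, branch `ψ` of the turn: scan right with
`ruleR`, append the right pad, (turn to `ψ`), scan back with `ruleL`, prepend the left pad. [cite: BernsteinVaziraniSICOMP1997, §4] -/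
def sweepOut (padL padR : S.C) (φ : S.Φ) (cs : List S.C) (ψ : S.Φ) : S.Φ × List S.C :=
  ((scan S.ruleL ψ (padR :: ((scan S.ruleR φ cs).2).reverse)).1,
    padL :: ((scan S.ruleL ψ (padR :: ((scan S.ruleR φ cs).2).reverse)).2).reverse)

/-- The amplitude of branch `ψ` of a sweep: the entry of `turn` at the register value reached at
the right end. [cite: BernsteinVaziraniSICOMP1997, §4] -/
def turnAmp (φ : S.Φ) (cs : List S.C) (ψ : S.Φ) : ℂ :=
  S.turn (scan S.ruleR φ cs).1 ψ

/-- A sweep lengthens the live stretch by two cells. [folklore] -/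
@[simp] theorem length_sweepOut (padL padR : S.C) (φ : S.Φ) (cs : List S.C) (ψ : S.Φ) :
    ((S.sweepOut padL padR φ cs ψ).2).length = cs.length + 2 := by
  simp [sweepOut]

/-- Not a turn pair unless the motion is `pushR`. [folklore] -/
theorem not_inTurn_of_ne {m : Motion} (hm : m ≠ Motion.pushR) (φ : S.Φ) (γ : S.Γ') :
    ¬ S.InTurn ((m, φ), γ) := fun h => hm h.1

/-- **One sweep of the sweep machine** (Bernstein–Vazirani 1997, §4: a loop iteration between
moving end markers; Nishimura–Ozawa 2002, Lemma 5.1: one round of the simulating machine). From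
motion `sweepR`, register `φ`, head on the first cell `p` of a live stretch `cs` delimited by
`D.dl` at `p - 1` and `D.dr` at `p + |cs|` on an otherwise blank tape, after exactly `2|cs| + 5`
steps the machine is in the superposition, over the branches `ψ` of the turn unitary (amplitude
`turnAmp φ cs ψ`), of the boundary configurations at `p - 1` with register and live stretch
`sweepOut D.padL D.padR φ cs ψ`. [cite: BernsteinVaziraniSICOMP1997, §4 (Lemmas 4.4–4.13)] -/
theorem sweep_spec_gen (D : S.Delims) (c : S.machine.PCfg) (φ : S.Φ) (cs : List S.C) (b : ℤ → S.Γ')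
    (a : ℂ) (hq : c.1.q = (Motion.sweepR, φ)) (hc : PCfg.cells c = paintDir 1 b c.2 (cs.map S.liveCell))
    (hdl : b (c.2 - 1) = D.dl) (hdr : b (c.2 + cs.length) = D.dr)
    (hb : ∀ z, z ≠ c.2 - 1 → z ≠ c.2 + cs.length → b z = none) :
    S.machine.pevolve^[2 * cs.length + 5] (Finsupp.single c a) =
      ∑ ψ : S.Φ, Finsupp.single (S.bdryCfg (c.2 - 1) (S.sweepOut D.padL D.padR φ cs ψ).1
        (S.sweepOut D.padL D.padR φ cs ψ).2) (a * S.turnAmp φ cs ψ) := by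
  have hbl : b (c.2 - 2) = none := hb _ (by omega) (by omega)
  have hbr : b (c.2 + cs.length + 1) = none := hb _ (by omega) (by omega)
  have hlen₁ : ((scan S.ruleR φ cs).2).length = cs.length := length_scan _ _ _
  -- Step A: the rightward pass
  obtain ⟨hA1, hA2, hA3, hA4⟩ :=
    S.pass_spec (m := Motion.sweepR) (Or.inl rfl) cs c φ b a hq (by simpa using hc)
  set c₁ := S.pass Motion.sweepR c φ cs with hc₁def
  simp only [rule_sweepR, mshift_sweepR, one_mul] at hA2 hA3 hA4
  -- Step B: the right delimiter becomes the right pad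
  have hhead₁ : c₁.1.tape.head = D.dr := by
    rw [head_eq_cells, hA3, hA4, paintDir_one_apply_of_le _ _ _ (by simp [hlen₁]), ← hdr]
  have hB : S.machine.pevolve (Finsupp.single c₁ a) =
      Finsupp.single (S.tgt c₁ ((Motion.pushR, (scan S.ruleR φ cs).1), S.liveCell D.padR)) a :=
    S.step_classical c₁ a (by rw [hA2, hhead₁]; exact D.table_dr _)
      (by rw [hA2, hhead₁]; exact S.not_inTurn_of_ne (by decide) _ _)
  set c₂ := S.tgt c₁ ((Motion.pushR, (scan S.ruleR φ cs).1), S.liveCell D.padR) with hc₂def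
  have h2q : c₂.1.q = (Motion.pushR, (scan S.ruleR φ cs).1) := rfl
  have h2p : c₂.2 = c.2 + cs.length + 1 := by rw [hc₂def, tgt_snd, hA3]; rfl
  have h2c : PCfg.cells c₂ = Function.update (paintDir 1 b c.2 ((scan S.ruleR φ cs).2.map S.liveCell))
      (c.2 + cs.length) (S.liveCell D.padR) := by
    rw [hc₂def, cells_tgt, hA4, hA3]
  -- Step C: the quantum turn
  have hhead₂ : c₂.1.tape.head = none := by
    rw [head_eq_cells, h2p, h2c, Function.update_of_ne (by omega),
      paintDir_one_apply_of_le _ _ _ (by simp [hlen₁]), ← hbr]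
  have hC := S.step_turn c₂ a _ h2q hhead₂
  -- Steps D–F on each branch `ψ`
  have hDEF : ∀ ψ : S.Φ, S.machine.pevolve^[2 + (cs.length + 1)]
      (Finsupp.single (S.tgt c₂ ((Motion.sweepL, ψ), some SCell.endR)) (a * S.turnAmp φ cs ψ)) =
      Finsupp.single (S.bdryCfg (c.2 - 1) (S.sweepOut D.padL D.padR φ cs ψ).1
        (S.sweepOut D.padL D.padR φ cs ψ).2) (a * S.turnAmp φ cs ψ) := by
    intro ψ
    set c₃ := S.tgt c₂ ((Motion.sweepL, ψ), some SCell.endR) with hc₃def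
    -- the cells met by the leftward pass, in the order met, and their background
    set e : List S.C := D.padR :: ((scan S.ruleR φ cs).2).reverse with he
    set b₃ : ℤ → S.Γ' := Function.update b (c.2 + cs.length + 1) (some SCell.endR) with hb₃
    have hlen_e : e.length = cs.length + 1 := by simp [he, hlen₁]
    have h3q : c₃.1.q = (Motion.sweepL, ψ) := rfl
    have h3p : c₃.2 = c.2 + cs.length := by rw [hc₃def, tgt_snd, h2p]; simp
    have h3c : PCfg.cells c₃ = paintDir (-1) b₃ c₃.2 (e.map S.liveCell) := by
      rw [hc₃def, cells_tgt, h2c, h2p, tgt_snd, h2p]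
      simp only [mshift_sweepL]
      rw [paintDir_neg_one_eq, he, List.map_cons, List.reverse_cons, List.map_reverse,
        List.reverse_reverse, paintDir_append, List.length_map, hlen₁, List.length_cons,
        List.length_reverse, List.length_map, hlen₁]
      have e1 : c.2 + ↑cs.length + 1 + -1 - (↑(cs.length + 1) : ℤ) + 1 = c.2 := by push_cast; ring
      have e2 : c.2 + 1 * (cs.length : ℤ) = c.2 + cs.length := by ring
      rw [e1, e2, paintDir_cons, paintDir_nil, Function.update_comm (by omega),
        update_paintDir_one_of_le _ _ _ (by simp [hlen₁]) (some SCell.endR)]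
    obtain ⟨hD1, hD2, hD3, hD4⟩ :=
      S.pass_spec (m := Motion.sweepL) (Or.inr rfl) e c₃ ψ b₃ (a * S.turnAmp φ cs ψ) h3q h3c
    set c₄ := S.pass Motion.sweepL c₃ ψ e with hc₄def
    simp only [rule_sweepL, mshift_sweepL] at hD2 hD3 hD4
    have hlen_o : ((scan S.ruleL ψ e).2).length = cs.length + 1 := by rw [length_scan, hlen_e]
    have h4p : c₄.2 = c.2 - 1 := by rw [hD3, h3p, hlen_e]; push_cast; ring
    have h4c : PCfg.cells c₄ = paintDir 1 b₃ c.2 (((scan S.ruleL ψ e).2.map S.liveCell).reverse) := by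
      rw [hD4, paintDir_neg_one_eq, h3p, List.length_map, hlen_o]
      congr 1; push_cast; ring
    -- Step E: the left delimiter becomes the left pad
    have hhead₄ : c₄.1.tape.head = D.dl := by
      rw [head_eq_cells, h4p, h4c, paintDir_apply_of_behind (Or.inl rfl) _ _ _ (by linarith), hb₃,
        Function.update_of_ne (by omega), ← hdl]
    have hE : S.machine.pevolve (Finsupp.single c₄ (a * S.turnAmp φ cs ψ)) =
        Finsupp.single (S.tgt c₄ ((Motion.pushL, (scan S.ruleL ψ e).1), S.liveCell D.padL))
          (a * S.turnAmp φ cs ψ) :=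
      S.step_classical c₄ _ (by rw [hD2, hhead₄]; exact D.table_dl _)
        (by rw [hD2, hhead₄]; exact S.not_inTurn_of_ne (by decide) _ _)
    set c₅ := S.tgt c₄ ((Motion.pushL, (scan S.ruleL ψ e).1), S.liveCell D.padL) with hc₅def
    have h5q : c₅.1.q = (Motion.pushL, (scan S.ruleL ψ e).1) := rfl
    have h5p : c₅.2 = c.2 - 2 := by rw [hc₅def, tgt_snd, h4p]; simp; ring
    have h5c : PCfg.cells c₅ = Function.update (paintDir 1 b₃ c.2 (((scan S.ruleL ψ e).2.map S.liveCell).reverse))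
        (c.2 - 1) (S.liveCell D.padL) := by rw [hc₅def, cells_tgt, h4c, h4p]
    -- Step F: write the left marker and turn right
    have hhead₅ : c₅.1.tape.head = none := by
      rw [head_eq_cells, h5p, h5c, Function.update_of_ne (by omega),
        paintDir_apply_of_behind (Or.inl rfl) _ _ _ (by linarith), hb₃, Function.update_of_ne (by omega),
        ← hbl]
    have hF : S.machine.pevolve (Finsupp.single c₅ (a * S.turnAmp φ cs ψ)) =
        Finsupp.single (S.tgt c₅ ((Motion.sweepR, (scan S.ruleL ψ e).1), some SCell.endL))
          (a * S.turnAmp φ cs ψ) :=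
      S.step_classical c₅ _ (by rw [h5q, hhead₅]; rfl)
        (by rw [h5q, hhead₅]; exact S.not_inTurn_of_ne (by decide) _ _)
    set c₆ := S.tgt c₅ ((Motion.sweepR, (scan S.ruleL ψ e).1), some SCell.endL) with hc₆def
    -- identify `c₆` with the boundary configuration
    have h6 : c₆ = S.bdryCfg (c.2 - 1) (S.sweepOut D.padL D.padR φ cs ψ).1
        (S.sweepOut D.padL D.padR φ cs ψ).2 := by
      have hout1 : (S.sweepOut D.padL D.padR φ cs ψ).1 = (scan S.ruleL ψ e).1 := rfl
      have hout2 : (S.sweepOut D.padL D.padR φ cs ψ).2 = D.padL :: ((scan S.ruleL ψ e).2).reverse := rfl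
      refine PCfg.ext_cells ?_ ?_ ?_
      · rw [bdryCfg_q, hout1]; rfl
      · rw [bdryCfg_snd, hc₆def, tgt_snd, h5p]; simp; ring
      · rw [cells_bdryCfg, hout2, hc₆def, cells_tgt, h5c, h5p, bdryCells,
          update_paintDir_of_behind (Or.inl rfl) _ _ _ (by linarith),
          update_paintDir_of_behind (Or.inl rfl) _ _ _ (by linarith), List.map_cons, paintDir_cons,
          List.map_reverse]
        have e3 : c.2 - 1 + 1 = c.2 := by ring
        rw [e3]
        refine paintDir_one_congr _ _ _ _ fun z hz => ?_
        rw [List.length_reverse, List.length_map, hlen_o] at hz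
        have hlen2 : (D.padL :: ((scan S.ruleL ψ e).2).reverse).length = cs.length + 2 := by
          simp [hlen_o]
        simp only [hlen2, hb₃]
        by_cases hz1 : z = c.2 - 1
        · subst hz1; simp
        rw [Function.update_of_ne hz1]
        by_cases hz2 : z = c.2 - 2
        · subst hz2
          have e4 : (c.2 - 2 : ℤ) = c.2 - 1 - 1 := by ring
          simp [markerBg, e4]
        rw [Function.update_of_ne hz2, Function.update_of_ne hz1]
        unfold markerBg
        rw [if_neg (by omega)]
        by_cases hz3 : z = c.2 + cs.length + 1
        · subst hz3
          rw [Function.update_self, if_pos (by push_cast; ring)]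
        rw [Function.update_of_ne hz3, hb z (by omega) (by omega), if_neg (by push_cast; omega)]
    -- assemble steps D, E, F
    rw [hlen_e] at hD1
    rw [Function.iterate_add_apply, hD1]
    show S.machine.pevolve (S.machine.pevolve (Finsupp.single c₄ _)) = _
    rw [hE, hF, h6]
  -- assemble everything
  have hsplit : 2 * cs.length + 5 = (2 + (cs.length + 1)) + (2 + cs.length) := by ring
  rw [hsplit, Function.iterate_add_apply, Function.iterate_add_apply S.machine.pevolve 2 cs.length, hA1]
  show S.machine.pevolve^[2 + (cs.length + 1)]
    (S.machine.pevolve (S.machine.pevolve (Finsupp.single c₁ a))) = _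
  rw [hB, hC, iterate_pevolve_finset_sum]
  refine Finset.sum_congr rfl fun ψ _ => ?_
  rw [Finsupp.smul_single_one]
  exact hDEF ψ

/-- **One sweep from a boundary configuration** (all sweeps but the first): `2|cs| + 5` steps
take the boundary configuration at `p` to the superposition of the boundary configurations at
`p - 1` given by `sweepOut pad pad` with amplitudes `turnAmp`. [cite: BernsteinVaziraniSICOMP1997, §4 (Lemmas 4.4–4.13)] -/
theorem sweep_spec (p : ℤ) (φ : S.Φ) (cs : List S.C) (a : ℂ) :
    S.machine.pevolve^[2 * cs.length + 5] (Finsupp.single (S.bdryCfg p φ cs) a) =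
      ∑ ψ : S.Φ, Finsupp.single (S.bdryCfg (p - 1) (S.sweepOut S.pad S.pad φ cs ψ).1
        (S.sweepOut S.pad S.pad φ cs ψ).2) (a * S.turnAmp φ cs ψ) := by
  have h := S.sweep_spec_gen S.markerDelims (S.bdryCfg p φ cs) φ cs (S.markerBg (p - 1) (p + cs.length)) a
    (S.bdryCfg_q p φ cs) (by rw [cells_bdryCfg, bdryCfg_snd]; rfl)
    (by rw [bdryCfg_snd]; simp [markerBg, markerDelims])
    (by rw [bdryCfg_snd]; have h : (p + cs.length : ℤ) ≠ p - 1 := by omega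
        simp [markerBg, markerDelims, h])
    (by intro z h1 h2; rw [bdryCfg_snd] at h1 h2; simp [markerBg, h1, h2])
  rw [bdryCfg_snd] at h
  exact h

/-- The cells of the initial configuration: the input word as live cells from position `0`, on a
blank tape (the tree's `QTM.init`, Mathlib's `Turing.Tape.mk₁`). [cite: BernsteinVaziraniSICOMP1997, Def. 3.2] -/
theorem cells_pinit (x : List Bool) :
    PCfg.cells (S.machine.pinit x) = paintDir 1 (fun _ => none) 0 ((x.map S.inp).map S.liveCell) := by
  funext z
  have hcell : PCfg.cells (S.machine.pinit x) z =
      (Tape.mk₁ ((x.map S.inp).map S.liveCell)).nth z := by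
    simp only [PCfg.cells, pinit, init, sub_zero, List.map_map]
    rfl
  rw [hcell]
  rcases lt_or_ge z 0 with hz | hz
  · obtain ⟨n, rfl⟩ := Int.eq_negSucc_of_lt_zero hz
    rw [paintDir_apply_of_behind (Or.inl rfl) _ _ _ (by have := Int.negSucc_lt_zero n; linarith)]
    show (Tape.mk' (ListBlank.mk []) (ListBlank.mk (((x.map S.inp).map S.liveCell)))).left.nth n = none
    simp
    rfl
  obtain ⟨n, rfl⟩ : ∃ n : ℕ, z = n := ⟨z.toNat, by omega⟩
  rcases lt_or_ge n ((x.map S.inp).map S.liveCell).length with hn | hn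
  · rw [show ((n : ℤ)) = 0 + n by ring, paintDir_one_apply_of_lt _ _ _ _ hn]
    simp only [zero_add, Tape.mk₁, Tape.mk₂, Tape.mk'_nth_nat, ListBlank.nth_mk]
    rw [List.getI_eq_getElem _ hn]
  · rw [paintDir_one_apply_of_le _ _ _ (by simpa using hn)]
    simp only [Tape.mk₁, Tape.mk₂, Tape.mk'_nth_nat, ListBlank.nth_mk]
    rw [List.getI_eq_default _ hn]
    rfl

/-- **The first sweep**: from the initial configuration on input `x`, `2|x| + 5` steps lead to
the superposition of boundary configurations at `-1` given by `sweepOut anchorL anchorR`. [cite: BernsteinVaziraniSICOMP1997, §4] -/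
theorem sweep0_spec (x : List Bool) :
    S.machine.pevolve^[2 * x.length + 5] (Finsupp.single (S.machine.pinit x) 1) =
      ∑ ψ : S.Φ, Finsupp.single (S.bdryCfg (-1) (S.sweepOut S.anchorL S.anchorR S.φ₀ (x.map S.inp) ψ).1
        (S.sweepOut S.anchorL S.anchorR S.φ₀ (x.map S.inp) ψ).2) (1 * S.turnAmp S.φ₀ (x.map S.inp) ψ) := by
  have hlen : x.length = (x.map S.inp).length := by simp
  have h := S.sweep_spec_gen S.blankDelims (S.machine.pinit x) S.φ₀ (x.map S.inp) (fun _ => none) 1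
    rfl (S.cells_pinit x) rfl rfl (fun _ _ _ => rfl)
  rw [hlen]
  exact h

/-! ### The sweep dynamics and the run theorem -/

/-- **The sweep dynamics** on superpositions of (register, live stretch): the linear map one sweep
induces (`sweepOut` with the branch amplitudes `turnAmp`), with the pads written at the ends as
parameters. [cite: BernsteinVaziraniSICOMP1997, §4] -/
def dynStep (padL padR : S.C) (v : S.Φ × List S.C →₀ ℂ) : S.Φ × List S.C →₀ ℂ :=
  v.sum fun b a => ∑ ψ : S.Φ, Finsupp.single (S.sweepOut padL padR b.1 b.2 ψ) (a * S.turnAmp b.1 b.2 ψ)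

/-- The pads of sweep `s`: the anchors on the first sweep, `pad` afterwards. [folklore] -/
def padsL : ℕ → S.C
  | 0 => S.anchorL
  | _ + 1 => S.pad

/-- The pads of sweep `s`, right end. [folklore] -/
def padsR : ℕ → S.C
  | 0 => S.anchorR
  | _ + 1 => S.pad

/-- **The sweep run**: the superposition of (register, live stretch) after `s` sweeps on input `x`. [cite: BernsteinVaziraniSICOMP1997, §4] -/
def dynRun (x : List Bool) : ℕ → (S.Φ × List S.C →₀ ℂ)
  | 0 => Finsupp.single (S.φ₀, x.map S.inp) 1
  | s + 1 => S.dynStep (S.padsL s) (S.padsR s) (dynRun x s)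

/-- **Sweep times**: the number of steps of the first `s` sweeps on an input of length `n`
(sweep `i` takes `2(n + 2i) + 5` steps). [cite: BernsteinVaziraniSICOMP1997, §4] -/
def sweepTime (n : ℕ) : ℕ → ℕ
  | 0 => 0
  | s + 1 => sweepTime n s + (2 * (n + 2 * s) + 5)

/-- Closed form: `sweepTime n s = 2s² + (2n + 3)s`, a polynomial in `n` and `s`. [folklore] -/
theorem sweepTime_eq (n s : ℕ) : sweepTime n s = 2 * s ^ 2 + (2 * n + 3) * s := by
  induction s with
  | zero => rfl
  | succ s ih => rw [sweepTime, ih]; ring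

/-- Live stretches in the sweep run after `s` sweeps have length `|x| + 2s`. [folklore] -/
theorem length_of_mem_support_dynRun (x : List Bool) (s : ℕ) :
    ∀ b ∈ (S.dynRun x s).support, b.2.length = x.length + 2 * s := by
  classical
  induction s with
  | zero =>
    intro b hb
    have hb' := Finsupp.support_single_subset hb
    rw [Finset.mem_singleton] at hb'
    subst hb'; simp
  | succ s ih =>
    intro b hb
    simp only [dynRun, dynStep] at hb
    obtain ⟨b', hb', hb''⟩ := Finset.mem_biUnion.1 (Finsupp.support_sum hb)
    obtain ⟨ψ, -, hψ⟩ := Finset.mem_biUnion.1 (Finsupp.support_finsetSum hb'')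
    have := Finsupp.support_single_subset hψ
    rw [Finset.mem_singleton] at this
    rw [this, length_sweepOut, ih b' hb']
    ring

/-- **The run theorem**: at the `(s+1)`-st sweep boundary the positioned superposition of the
sweep machine on input `x` is the image of the sweep run under the (injective) boundary
encoding at head position `-(s+1)` (Bernstein–Vazirani 1997, §4: the configuration of a looping
construction each time the loop is re-entered; NO 2002, Lemma 5.1). [cite: BernsteinVaziraniSICOMP1997, §4] -/
theorem pstateAt_sweepTime (x : List Bool) (s : ℕ) :
    S.machine.pstateAt x (sweepTime x.length (s + 1)) =
      (S.dynRun x (s + 1)).sum fun b a => Finsupp.single (S.bdryCfg (-(s + 1 : ℕ)) b.1 b.2) a := by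
  induction s with
  | zero =>
    have ht : sweepTime x.length 1 = 2 * x.length + 5 := by simp [sweepTime]
    rw [pstateAt, ht, S.sweep0_spec x]
    simp only [dynRun, dynStep, padsL, padsR]
    rw [Finsupp.sum_single_index (by simp), ← Finsupp.sum_finsetSum_index (by simp)
      (fun _ _ _ => Finsupp.single_add _ _ _)]
    refine Finset.sum_congr rfl fun ψ _ => ?_
    rw [Finsupp.sum_single_index (Finsupp.single_zero _)]
    norm_num
  | succ s ih =>
    have ht : sweepTime x.length (s + 2) = (2 * (x.length + 2 * (s + 1)) + 5) + sweepTime x.length (s + 1) := by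
      rw [sweepTime]; ring
    rw [pstateAt, ht, Function.iterate_add_apply, ← pstateAt, ih, iterate_pevolve_finsupp_sum]
    conv_rhs => rw [dynRun, dynStep, Finsupp.sum_sum_index (by simp) (fun _ _ _ => Finsupp.single_add _ _ _)]
    refine Finsupp.sum_congr fun b hb => ?_
    have hlen := S.length_of_mem_support_dynRun x (s + 1) b hb
    rw [show 2 * (x.length + 2 * (s + 1)) + 5 = 2 * b.2.length + 5 by rw [hlen]]
    rw [S.sweep_spec, ← Finsupp.sum_finsetSum_index (by simp) (fun _ _ _ => Finsupp.single_add _ _ _)]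
    refine Finset.sum_congr rfl fun ψ _ => ?_
    rw [Finsupp.sum_single_index (Finsupp.single_zero _)]
    have e : (-(↑(s + 1) : ℤ) - 1) = -↑(s + 1 + 1) := by push_cast; ring
    rw [e]
    rfl

/-- **Obliviousness at sweep boundaries** (Bernstein–Vazirani 1997, App. B, Def. B.5: the head
position depends only on the time and the input length): at the `(s+1)`-st sweep boundary every
configuration with non-zero amplitude has head position `-(s+1)`. [cite: BernsteinVaziraniSICOMP1997, App. B (Def. B.5)] -/
theorem oblivious_sweepTime (x : List Bool) (s : ℕ) :
    ∀ c ∈ (S.machine.pstateAt x (sweepTime x.length (s + 1))).support, c.2 = -(s + 1 : ℕ) := by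
  classical
  intro c hc
  rw [pstateAt_sweepTime] at hc
  obtain ⟨b, -, hb⟩ := Finset.mem_biUnion.1 (Finsupp.support_sum hc)
  have := Finsupp.support_single_subset hb
  rw [Finset.mem_singleton] at this
  rw [this, bdryCfg_snd]

/-- The run theorem in `mapDomain` form. [cite: BernsteinVaziraniSICOMP1997, §4] -/
theorem pstateAt_sweepTime_eq_mapDomain (x : List Bool) (s : ℕ) :
    S.machine.pstateAt x (sweepTime x.length (s + 1)) =
      Finsupp.mapDomain (fun b : S.Φ × List S.C => S.bdryCfg (-(s + 1 : ℕ)) b.1 b.2) (S.dynRun x (s + 1)) :=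
  S.pstateAt_sweepTime x s

/-- **The acceptance probability at a sweep boundary** is the weight, in the sweep run, of the
register values equal to the accepting value `φa` (positioned model, Bernstein–Vazirani 1997,
Def. 3.4). [cite: BernsteinVaziraniSICOMP1997, Def. 3.4] -/
theorem pacceptProbAt_sweepTime (x : List Bool) (s : ℕ) :
    S.machine.pacceptProbAt x (sweepTime x.length (s + 1)) =
      (S.dynRun x (s + 1)).sum fun b a => if b.1 = S.φa then ‖a‖ ^ 2 else 0 := by
  rw [pacceptProbAt, pstateAt_sweepTime_eq_mapDomain,
    Finsupp.sum_mapDomain_index_inj (S.bdryCfg_injective _)]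
  refine Finsupp.sum_congr fun b _ => ?_
  simp [bdryCfg_q]

/-- **The tree's acceptance probability agrees** at sweep boundaries (obliviousness,
`QTM.acceptProbAt_eq_pacceptProbAt`). [cite: BernsteinVaziraniSICOMP1997, Def. 3.4 and App. B (Def. B.5)] -/
theorem acceptProbAt_sweepTime (x : List Bool) (s : ℕ) :
    S.machine.acceptProbAt x (sweepTime x.length (s + 1)) =
      (S.dynRun x (s + 1)).sum fun b a => if b.1 = S.φa then ‖a‖ ^ 2 else 0 := by
  rw [S.machine.acceptProbAt_eq_pacceptProbAt x _ _ (S.oblivious_sweepTime x s)]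
  exact S.pacceptProbAt_sweepTime x s

end SweepSpec

end QTM

end Literature.Computability.Cryptography
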